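/-
Copyright: H21 programme, solo seat `solo-RiemannHypothesis-informed` (session 5).
-/
import Summits.RiemannHypothesis.RiemannHypothesis.Theorems.SoloInformedNearCount

/-!
# Multi-pair visibility and un-dodged near zeros (solo-informed, T37a)

Two additions to the defect calculus of `SoloInformedGroundStateDipole`:

* **Multi-pair visibility** (`weilGroundEnergy_le_of_pairs`): for ANY finite set `P` of
  non-trivial zeros, `Re Q(g) ≤ B − ½ Σ_{ρ ∈ P} m(ρ)|ĝ(ρ) − ĝ(1 − ρ̄)|²` whenever `sup_T Z_T(g) ≤ B`
  (the defect sum is termwise non-negative, so any finite part of it may be kept).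
* **Un-dodged zeros are free when gain-signed**
  (`weilGroundEnergy_le_local_of_oddTest_cluster_far_undodged`, T37a): the net contribution of
  a zero `ρ` KEPT in the explicit formula (its sampling term minus half its defect term) is
  `m(ρ)(|ĝ(ρ)|² − ½|ĝ(ρ) − ĝ(1 − ρ̄)|²)`, so the cluster inequality T28b
  (`weilGroundEnergy_le_local_of_oddTest_cluster_far`) holds VERBATIM when the local hypothesis
  admits, besides the pair `½ ± η + iγ₀` and the dodged set `S'`, a further finite set `P` of
  off-line zeros at which `|ĝ(ρ)|² ≤ ½|ĝ(ρ) − ĝ(1 − ρ̄)|²` — no dodging and no separation needed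
  for them.  (For the twist `g = k·e^{−iγ₀t}` of an odd `k`, `ĝ(1 − ρ̄) = −k̂` at the conjugate
  point, so zeros very close to the pair have gain-signed phase: this is the mechanism by which
  the separation `δ` of the near-count wall T36 can be removed; the phase estimate for the actual
  cluster test is a separate matter.)
-/

open MeasureTheory Complex Set Filter Topology Literature.NumberTheory.LFunctions
open scoped ContDiff ComplexConjugate

namespace Summit.RiemannHypothesis.RiemannHypothesis.Theorems

section MultiPair

variable {g : ℝ → ℂ}

/-- Any finite part of the defect sum is below the whole defect sum. -/
theorem sum_pairDefect_le_defectSum (g : ℝ → ℂ) {T : ℝ} {P : Finset ℂ}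
    (hP : ∀ ρ ∈ P, ρ ∈ weilZeroIndex T) :
    ∑ ρ ∈ P, (riemannZetaZeroOrder ρ : ℝ) * ‖weilMellin g ρ - weilMellin g (1 - conj ρ)‖ ^ 2 ≤
      ∑ᶠ ρ ∈ weilZeroIndex T,
        (riemannZetaZeroOrder ρ : ℝ) * ‖weilMellin g ρ - weilMellin g (1 - conj ρ)‖ ^ 2 := by
  have hfin := weilZeroIndex_finite T
  rw [finsum_mem_eq_finite_toFinset_sum _ hfin]
  refine Finset.sum_le_sum_of_subset_of_nonneg (fun ρ hρ ↦ hfin.mem_toFinset.2 (hP ρ hρ)) ?_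
  intro ρ hρ _
  exact mul_nonneg (riemannZetaZeroOrder_nonneg_of_mem_weilZeroIndex (hfin.mem_toFinset.1 hρ))
    (sq_nonneg _)

/-- **Multi-pair visibility, truncated form**:
`Re Q_T(g) ≤ Z_T(g) − ½ Σ_{ρ ∈ P} m(ρ)|ĝ(ρ) − ĝ(1 − ρ̄)|²` for indexed `P`. -/
theorem re_weilZeroSidePartial_weilQuadratic_le_zeroSum_sub_sum (hg : IsWeilTest g) {T : ℝ}
    {P : Finset ℂ} (hP : ∀ ρ ∈ P, ρ ∈ weilZeroIndex T) :
    (weilZeroSidePartial (weilConv g (weilReflect g)) T).re ≤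
      (∑ᶠ ρ ∈ weilZeroIndex T, (riemannZetaZeroOrder ρ : ℝ) * ‖weilMellin g ρ‖ ^ 2) -
        (∑ ρ ∈ P, (riemannZetaZeroOrder ρ : ℝ) *
          ‖weilMellin g ρ - weilMellin g (1 - conj ρ)‖ ^ 2) / 2 := by
  rw [re_weilZeroSidePartial_weilQuadratic_eq hg T]
  have := sum_pairDefect_le_defectSum g hP
  linarith

/-- **Multi-pair visibility for `Q`**: `Re Q(g) ≤ B − ½ Σ_{ρ ∈ P} m(ρ)|ĝ(ρ) − ĝ(1 − ρ̄)|²` for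
every finite set `P` of zeros with `0 ≤ Re ρ ≤ 1`, `Im ρ ≠ 0`, if `sup_T Z_T(g) ≤ B`. -/
theorem re_weilQuadratic_le_of_zeroSum_le_sub_sum (hg : IsWeilTest g) {P : Finset ℂ}
    (hP : ∀ ρ ∈ P, riemannZeta ρ = 0 ∧ 0 ≤ ρ.re ∧ ρ.re ≤ 1 ∧ ρ.im ≠ 0) {B : ℝ}
    (hB : ∀ T : ℝ,
      ∑ᶠ ρ ∈ weilZeroIndex T, (riemannZetaZeroOrder ρ : ℝ) * ‖weilMellin g ρ‖ ^ 2 ≤ B) :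
    (weilQuadratic g).re ≤
      B - (∑ ρ ∈ P, (riemannZetaZeroOrder ρ : ℝ) *
        ‖weilMellin g ρ - weilMellin g (1 - conj ρ)‖ ^ 2) / 2 := by
  have hk : IsWeilTest (weilConv g (weilReflect g)) := hg.weilConv hg.weilReflect
  have hlim : Tendsto (fun T ↦ (weilZeroSidePartial (weilConv g (weilReflect g)) T).re) atTop
      (𝓝 (weilQuadratic g).re) :=
    (Complex.continuous_re.tendsto _).comp (explicit_formula_holds hk)
  refine le_of_tendsto hlim ?_
  filter_upwards [eventually_ge_atTop (∑ ρ ∈ P, |ρ.im|)] with T hT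
  have hPT : ∀ ρ ∈ P, ρ ∈ weilZeroIndex T := by
    intro ρ hρ
    obtain ⟨hz, h0, h1, him⟩ := hP ρ hρ
    refine ⟨hz, h0, h1, him, ?_⟩
    exact (Finset.single_le_sum (fun ρ _ ↦ abs_nonneg (Complex.im ρ)) hρ).trans hT
  exact (re_weilZeroSidePartial_weilQuadratic_le_zeroSum_sub_sum hg hPT).trans
    (by linarith [hB T])

/-- **Multi-pair visibility for the ground energy**:
`ε(a) ≤ (B − ½ Σ_{ρ ∈ P} m(ρ)|ĝ(ρ) − ĝ(1 − ρ̄)|²) / ‖g‖₂²`. -/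
theorem weilGroundEnergy_le_of_pairs (hg : IsWeilTest g) {a : ℝ}
    (hgs : tsupport g ⊆ Icc (-a) a) (hpos : 0 < ∫ t, ‖g t‖ ^ 2) {P : Finset ℂ}
    (hP : ∀ ρ ∈ P, riemannZeta ρ = 0 ∧ 0 ≤ ρ.re ∧ ρ.re ≤ 1 ∧ ρ.im ≠ 0) {B : ℝ}
    (hB : ∀ T : ℝ,
      ∑ᶠ ρ ∈ weilZeroIndex T, (riemannZetaZeroOrder ρ : ℝ) * ‖weilMellin g ρ‖ ^ 2 ≤ B) :
    weilGroundEnergy a ≤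
      (B - (∑ ρ ∈ P, (riemannZetaZeroOrder ρ : ℝ) *
        ‖weilMellin g ρ - weilMellin g (1 - conj ρ)‖ ^ 2) / 2) / ∫ t, ‖g t‖ ^ 2 :=
  (weilGroundEnergy_le_div hg hgs hpos).trans
    (div_le_div_of_nonneg_right (re_weilQuadratic_le_of_zeroSum_le_sub_sum hg hP hB) hpos.le)

end MultiPair

section Undodged

/-- Union bound for sums of non-negative terms. -/
theorem sum_union_le_of_nonneg {ι : Type*} [DecidableEq ι] {s t : Finset ι} {f : ι → ℝ}
    (h : ∀ x ∈ s ∪ t, 0 ≤ f x) : ∑ x ∈ s ∪ t, f x ≤ ∑ x ∈ s, f x + ∑ x ∈ t, f x := by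
  have := Finset.sum_union_inter (s₁ := s) (s₂ := t) (f := f)
  have hI : 0 ≤ ∑ x ∈ s ∩ t, f x :=
    Finset.sum_nonneg fun x hx ↦ h x (Finset.mem_union_left _ (Finset.mem_inter.mp hx).1)
  linarith

/-- **T37a (T28b for clusters with un-dodged gain-signed zeros).**  As
`weilGroundEnergy_le_local_of_oddTest_cluster_far` (dodged set `S'`, bounded far set `S_f`),
with a further finite set `P` of off-line zeros exempted from the local hypothesis at which
`|ĝ(ρ)|² ≤ ½|ĝ(ρ) − ĝ(1 − ρ̄)|²` (the twisted transform is gain-signed); the conclusion is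
unchanged. -/
theorem weilGroundEnergy_le_local_of_oddTest_cluster_far_undodged :
    ∀ (k : ℝ → ℂ) (a η γ₀ R Bf : ℝ) (n : ℕ) (S' Sf P : Finset ℂ), IsWeilTest k →
      (∀ t, k (-t) = -k t) → 0 ≤ a → 1 ≤ R → tsupport k ⊆ Icc (-a) a →
      0 < ∫ t, ‖k t‖ ^ 2 → riemannZeta (1 / 2 + η + γ₀ * I) = 0 → |η| < 1 / 2 →
      η ≠ 0 → γ₀ ≠ 0 →
      (∀ ρ ∈ S', weilMellin (fun t ↦ k t * cexp (-(γ₀ * I) * t)) ρ = 0) →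
      (∀ ρ ∈ Sf, ρ ≠ 1) →
      (∑ ρ ∈ Sf, (riemannZetaZeroOrder ρ : ℝ) *
          ‖weilMellin (fun t ↦ k t * cexp (-(γ₀ * I) * t)) ρ‖ ^ 2 ≤ Bf) →
      (∀ ρ ∈ P, riemannZeta ρ = 0 ∧ 0 ≤ ρ.re ∧ ρ.re ≤ 1 ∧ ρ.im ≠ 0 ∧
          ‖weilMellin (fun t ↦ k t * cexp (-(γ₀ * I) * t)) ρ‖ ^ 2 ≤
            ‖weilMellin (fun t ↦ k t * cexp (-(γ₀ * I) * t)) ρ -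
              weilMellin (fun t ↦ k t * cexp (-(γ₀ * I) * t)) (1 - conj ρ)‖ ^ 2 / 2) →
      (∀ ρ : ℂ, riemannZeta ρ = 0 → 0 ≤ ρ.re → ρ.re ≤ 1 → |ρ.im - γ₀| < R → ρ.re ≠ 1 / 2 →
          ρ = 1 / 2 + η + γ₀ * I ∨ ρ = 1 / 2 - η + γ₀ * I ∨ ρ ∈ S' ∨ ρ ∈ Sf ∨ ρ ∈ P) →
        weilGroundEnergy a ≤
          (2 * zetaDensityConst * (((∫ t : ℝ, ‖k t‖) ^ 2 + (∫ t : ℝ, ‖deriv k t‖) ^ 2)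
                + 2 * Real.exp a * (∫ t : ℝ, ‖iteratedDeriv (n + 1) k t‖) ^ 2 / R ^ (2 * n))
              * Real.log (|γ₀| + 2) + Bf
            - 2 * ((riemannZetaZeroOrder (1 / 2 + η + γ₀ * I) : ℝ)
                * ‖∫ t : ℝ, k t * cexp ((η : ℂ) * t)‖ ^ 2))
            / ∫ t, ‖k t‖ ^ 2 := by
  intro k a η γ₀ R Bf n S' Sf P hk hodd ha hR hks hpos hζ hη hη0 hγ hvan hSf1 hBf hP hloc
  have hS := weilSamplingEnergy_le_local_eff
  classical
  set g : ℝ → ℂ := fun t ↦ k t * cexp (-(γ₀ * I) * t) with hg_def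
  set ρ₀ : ℂ := 1 / 2 + η + γ₀ * I with hρ₀
  set ρ₁ : ℂ := 1 / 2 - η + γ₀ * I with hρ₁
  set G : ℝ := ‖∫ t : ℝ, k t * cexp ((η : ℂ) * t)‖ ^ 2 with hG
  set m₀ : ℝ := (riemannZetaZeroOrder ρ₀ : ℝ) with hm₀
  -- the un-dodged set without the pair
  set P' : Finset ℂ := P.filter (fun ρ ↦ ρ ≠ ρ₀ ∧ ρ ≠ ρ₁) with hP'_def
  have hP'sub : ∀ ρ ∈ P', ρ ∈ P ∧ ρ ≠ ρ₀ ∧ ρ ≠ ρ₁ := fun ρ hρ ↦ by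
    simpa [hP'_def, Finset.mem_filter] using hρ
  have hne : ρ₀ ≠ ρ₁ := by
    intro h01
    have := congrArg Complex.re h01
    simp [hρ₀, hρ₁] at this
    exact hη0 (by linarith)
  have hρ₀1 : ρ₀ ≠ 1 := by
    intro h1; have := congrArg Complex.im h1; simp [hρ₀] at this; exact hγ this
  have hρ₁1 : ρ₁ ≠ 1 := by
    intro h1; have := congrArg Complex.im h1; simp [hρ₁] at this; exact hγ this
  -- exceptional set `E = ({ρ₀, ρ₁} ∪ S'.erase 1 ∪ S_f) ∪ P'`
  set A : Finset ℂ := {ρ₀, ρ₁} ∪ S'.erase 1 with hA_def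
  set E : Finset ℂ := (A ∪ Sf) ∪ P' with hE_def
  have hA1 : ∀ ρ ∈ A, ρ ≠ 1 := by
    intro ρ hρ
    rcases Finset.mem_union.mp hρ with hp | hs
    · rcases Finset.mem_insert.mp hp with h0 | h1
      · rw [h0]; exact hρ₀1
      · rw [Finset.mem_singleton.mp h1]; exact hρ₁1
    · exact (Finset.mem_erase.mp hs).1
  have hE1 : ∀ ρ ∈ E, ρ ≠ 1 := by
    intro ρ hρ
    rcases Finset.mem_union.mp hρ with hρ' | hp
    · rcases Finset.mem_union.mp hρ' with ha' | hf
      · exact hA1 ρ ha'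
      · exact hSf1 ρ hf
    · rintro rfl
      exact riemannZeta_one_ne_zero (hP 1 (hP'sub 1 hp).1).1
  have hlocE : ∀ ρ : ℂ, riemannZeta ρ = 0 → 0 ≤ ρ.re → ρ.re ≤ 1 → |ρ.im - γ₀| < R →
      ρ ∉ E → ρ.re = 1 / 2 := by
    intro ρ hz h0 h1 hnear hρE
    by_contra hre
    have hρ1 : ρ ≠ 1 := by rintro rfl; exact riemannZeta_one_ne_zero hz
    apply hρE
    have h0A : ρ₀ ∈ A := Finset.mem_union_left _ (by simp)
    have h1A : ρ₁ ∈ A := Finset.mem_union_left _ (by simp)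
    rcases hloc ρ hz h0 h1 hnear hre with h | h | h | h | h
    · exact Finset.mem_union_left _ (Finset.mem_union_left _ (by rw [h]; exact h0A))
    · exact Finset.mem_union_left _ (Finset.mem_union_left _ (by rw [h]; exact h1A))
    · exact Finset.mem_union_left _ (Finset.mem_union_left _
        (Finset.mem_union_right _ (Finset.mem_erase.mpr ⟨hρ1, h⟩)))
    · exact Finset.mem_union_left _ (Finset.mem_union_right _ h)
    · by_cases hp0 : ρ = ρ₀
      · exact Finset.mem_union_left _ (Finset.mem_union_left _ (by rw [hp0]; exact h0A))
      by_cases hp1 : ρ = ρ₁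
      · exact Finset.mem_union_left _ (Finset.mem_union_left _ (by rw [hp1]; exact h1A))
      exact Finset.mem_union_right _ (by
        rw [hP'_def, Finset.mem_filter]; exact ⟨h, hp0, hp1⟩)
  have hB := hS k a γ₀ R n E hk ha hR hks hE1 hlocE
  -- values at the pair
  have e1 : ∀ (f : ℝ → ℂ) (c : ℝ), ∫ t : ℝ, f t * cexp ((c : ℂ) * t) =
      weilMellin f (1 / 2 + c) := by
    intro f c; unfold weilMellin; congr 1 with t; congr 2; ring
  have hval : ∀ c : ℝ, ‖weilMellin g (1 / 2 + c + γ₀ * I)‖ ^ 2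
      = ‖∫ t : ℝ, k t * cexp ((c : ℂ) * t)‖ ^ 2 := by
    intro c
    rw [hg_def, weilMellin_mul_cexp]
    have e0 : (1 / 2 + (c : ℂ) + γ₀ * I + -(γ₀ * I)) = 1 / 2 + c := by ring
    rw [e0, e1]
  have hval0 : ‖weilMellin g ρ₀‖ ^ 2 = G := by rw [hρ₀, hval η]
  have hint : ∫ t : ℝ, k t * cexp (((-η : ℝ) : ℂ) * t) =
      -∫ t : ℝ, k t * cexp ((η : ℂ) * t) := by
    rw [← integral_odd_mul_cexp_neg hodd η]
    congr 1 with t; push_cast; ring_nf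
  have eρ₁ : ρ₁ = 1 / 2 + ((-η : ℝ) : ℂ) + γ₀ * I := by rw [hρ₁]; push_cast; ring
  have hval1 : ‖weilMellin g ρ₁‖ ^ 2 = G := by
    rw [eρ₁, hval (-η), hG, hint, norm_neg]
  have h0ρ : 0 < ρ₀.re := by have := (abs_lt.mp hη).1; simp [hρ₀]; linarith
  have h1ρ : ρ₀.re < 1 := by have := (abs_lt.mp hη).2; simp [hρ₀]; linarith
  have hm1 : (riemannZetaZeroOrder ρ₁ : ℝ) = m₀ := by
    have e : ρ₁ = conj (1 - ρ₀) := by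
      apply Complex.ext
      · simp [hρ₀, hρ₁]; ring
      · simp [hρ₀, hρ₁]
    rw [hm₀, e, riemannZetaZeroOrder_conj_holds (1 - ρ₀),
      riemannZetaZeroOrder_one_sub_holds h0ρ h1ρ]
  have hm₀0 : 0 ≤ m₀ := by rw [hm₀]; exact riemannZetaZeroOrder_nonneg_of_zero hζ
  have hmnn : ∀ ρ : ℂ, ρ ≠ 1 → (0 : ℝ) ≤ riemannZetaZeroOrder ρ :=
    fun ρ h ↦ Int.cast_nonneg (riemannZetaZeroOrder_nonneg h)
  -- defects at the pair: both equal `4G`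
  have hdef0 : ‖weilMellin g ρ₀ - weilMellin g (1 - conj ρ₀)‖ ^ 2 = 4 * G := by
    rw [hρ₀, hg_def, weilMellin_twist_sub_reflect hodd η γ₀, norm_mul, mul_pow, hG,
      Complex.norm_two]
    norm_num
  have hdef1 : ‖weilMellin g ρ₁ - weilMellin g (1 - conj ρ₁)‖ ^ 2 = 4 * G := by
    rw [eρ₁, hg_def, weilMellin_twist_sub_reflect hodd (-η) γ₀, norm_mul, mul_pow, hG,
      Complex.norm_two, hint, norm_neg]
    norm_num
  -- the sampling bound: `Z_T ≤ Maj + 2 m₀ G + B_f + Σ_{P'} m |ĝ|²`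
  set Maj : ℝ := 2 * zetaDensityConst * (((∫ t : ℝ, ‖k t‖) ^ 2 + (∫ t : ℝ, ‖deriv k t‖) ^ 2)
      + 2 * Real.exp a * (∫ t : ℝ, ‖iteratedDeriv (n + 1) k t‖) ^ 2 / R ^ (2 * n))
      * Real.log (|γ₀| + 2) with hMaj
  set ZP : ℝ := ∑ ρ ∈ P', (riemannZetaZeroOrder ρ : ℝ) * ‖weilMellin g ρ‖ ^ 2 with hZP
  have hsumP : ∑ ρ ∈ ({ρ₀, ρ₁} : Finset ℂ), (riemannZetaZeroOrder ρ : ℝ) *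
      ‖weilMellin g ρ‖ ^ 2 = 2 * (m₀ * G) := by
    rw [Finset.sum_pair hne, hval0, hval1, hm1]
    ring
  have hsum1 : ∑ ρ ∈ A, (riemannZetaZeroOrder ρ : ℝ) * ‖weilMellin g ρ‖ ^ 2 =
      2 * (m₀ * G) := by
    rw [← hsumP, hA_def]
    symm
    refine Finset.sum_subset Finset.subset_union_left fun ρ hρS hρP ↦ ?_
    rcases Finset.mem_union.mp hρS with hp | hs
    · exact absurd hp hρP
    · rw [hg_def, hvan ρ (Finset.mem_of_mem_erase hs), norm_zero]
      ring
  have hnnE : ∀ ρ ∈ (A ∪ Sf) ∪ P', 0 ≤ (riemannZetaZeroOrder ρ : ℝ) * ‖weilMellin g ρ‖ ^ 2 :=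
    fun ρ hρ ↦ mul_nonneg (hmnn ρ (hE1 ρ hρ)) (sq_nonneg _)
  have hBf' : ∑ ρ ∈ Sf, (riemannZetaZeroOrder ρ : ℝ) * ‖weilMellin g ρ‖ ^ 2 ≤ Bf := hBf
  have hsumE : ∑ ρ ∈ E, (riemannZetaZeroOrder ρ : ℝ) * ‖weilMellin g ρ‖ ^ 2 ≤
      2 * (m₀ * G) + Bf + ZP := by
    have h1 := sum_union_le_of_nonneg (s := A ∪ Sf) (t := P')
      (f := fun ρ ↦ (riemannZetaZeroOrder ρ : ℝ) * ‖weilMellin g ρ‖ ^ 2) hnnE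
    have h2 := sum_union_le_of_nonneg (s := A) (t := Sf)
      (f := fun ρ ↦ (riemannZetaZeroOrder ρ : ℝ) * ‖weilMellin g ρ‖ ^ 2)
      (fun ρ hρ ↦ hnnE ρ (Finset.mem_union_left _ hρ))
    rw [hsum1] at h2
    rw [hE_def, hZP]
    linarith
  have hB' : ∀ T : ℝ, ∑ᶠ ρ ∈ weilZeroIndex T, (riemannZetaZeroOrder ρ : ℝ) *
      ‖weilMellin g ρ‖ ^ 2 ≤ Maj + Bf + 2 * (m₀ * G) + ZP := by
    intro T
    have := hB T
    rw [← hg_def] at this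
    linarith [hsumE]
  -- multi-pair visibility with `Q = {ρ₀, ρ₁} ∪ P'`
  have hg : IsWeilTest g := isWeilTest_mul_cexp hk _
  have hgs : tsupport g ⊆ Icc (-a) a := tsupport_mul_subset_left.trans hks
  have hnorm : (∫ t, ‖g t‖ ^ 2) = ∫ t, ‖k t‖ ^ 2 := by
    congr 1 with t; rw [hg_def, norm_mul_cexp_neg_mul_I]
  have hposg : 0 < ∫ t, ‖g t‖ ^ 2 := by rwa [hnorm]
  have hQ : ∀ ρ ∈ ({ρ₀, ρ₁} ∪ P' : Finset ℂ),
      riemannZeta ρ = 0 ∧ 0 ≤ ρ.re ∧ ρ.re ≤ 1 ∧ ρ.im ≠ 0 := by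
    intro ρ hρ
    rcases Finset.mem_union.mp hρ with hp | hp
    · have him0 : ρ₀.im = γ₀ := by simp [hρ₀]
      have him1 : ρ₁.im = γ₀ := by simp [hρ₁]
      have hre1 : ρ₁.re = 1 / 2 - η := by simp [hρ₁]
      rcases Finset.mem_insert.mp hp with h0 | h1
      · rw [h0]; exact ⟨hζ, h0ρ.le, h1ρ.le, by rwa [him0]⟩
      · rw [Finset.mem_singleton.mp h1]
        have hζ1 : riemannZeta ρ₁ = 0 := by rw [hρ₁]; exact riemannZeta_zero_reflect hη hζ
        refine ⟨hζ1, ?_, ?_, by rwa [him1]⟩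
        · rw [hre1]; linarith [(abs_lt.mp hη).2]
        · rw [hre1]; linarith [(abs_lt.mp hη).1]
    · obtain ⟨hz, h0, h1, him, -⟩ := hP ρ (hP'sub ρ hp).1
      exact ⟨hz, h0, h1, him⟩
  have key := weilGroundEnergy_le_of_pairs hg hgs hposg hQ hB'
  rw [hnorm] at key
  refine key.trans (div_le_div_of_nonneg_right ?_ hpos.le)
  -- the defect sum over `Q`
  have hdisj : Disjoint ({ρ₀, ρ₁} : Finset ℂ) P' := by
    rw [Finset.disjoint_left]
    intro ρ hρ hρP
    obtain ⟨-, h0, h1⟩ := hP'sub ρ hρP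
    rcases Finset.mem_insert.mp hρ with h | h
    · exact h0 h
    · exact h1 (Finset.mem_singleton.mp h)
  rw [Finset.sum_union hdisj, Finset.sum_pair hne, hdef0, hdef1, hm1]
  -- net contribution of `P'` is non-positive
  have hnet : ZP - (∑ ρ ∈ P', (riemannZetaZeroOrder ρ : ℝ) *
      ‖weilMellin g ρ - weilMellin g (1 - conj ρ)‖ ^ 2) / 2 ≤ 0 := by
    rw [hZP, Finset.sum_div, ← Finset.sum_sub_distrib]
    refine Finset.sum_nonpos fun ρ hρ ↦ ?_
    obtain ⟨hz, -, -, -, hsign⟩ := hP ρ (hP'sub ρ hρ).1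
    have hm : 0 ≤ (riemannZetaZeroOrder ρ : ℝ) := riemannZetaZeroOrder_nonneg_of_zero hz
    have hsign' : ‖weilMellin g ρ‖ ^ 2 ≤
        ‖weilMellin g ρ - weilMellin g (1 - conj ρ)‖ ^ 2 / 2 := hsign
    have e : (riemannZetaZeroOrder ρ : ℝ) * ‖weilMellin g ρ‖ ^ 2 -
        (riemannZetaZeroOrder ρ : ℝ) * ‖weilMellin g ρ - weilMellin g (1 - conj ρ)‖ ^ 2 / 2 =
        (riemannZetaZeroOrder ρ : ℝ) *
          (‖weilMellin g ρ‖ ^ 2 - ‖weilMellin g ρ - weilMellin g (1 - conj ρ)‖ ^ 2 / 2) := by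
      ring
    rw [e]
    nlinarith [hm, hsign']
  linarith [hnet]

/-- **T37a (threshold form).**  If `majorant·log(|γ₀|+2) + B_f < 2m(ρ₀)|∫ k e^{ηt}|²` then
`ε(a) < 0`, with the un-dodged set `P` as above. -/
theorem weilGroundEnergy_neg_of_local_oddTest_cluster_far_undodged :
    ∀ (k : ℝ → ℂ) (a η γ₀ R Bf : ℝ) (n : ℕ) (S' Sf P : Finset ℂ), IsWeilTest k →
      (∀ t, k (-t) = -k t) → 0 ≤ a → 1 ≤ R → tsupport k ⊆ Icc (-a) a →
      0 < ∫ t, ‖k t‖ ^ 2 → riemannZeta (1 / 2 + η + γ₀ * I) = 0 → |η| < 1 / 2 →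
      η ≠ 0 → γ₀ ≠ 0 →
      (∀ ρ ∈ S', weilMellin (fun t ↦ k t * cexp (-(γ₀ * I) * t)) ρ = 0) →
      (∀ ρ ∈ Sf, ρ ≠ 1) →
      (∑ ρ ∈ Sf, (riemannZetaZeroOrder ρ : ℝ) *
          ‖weilMellin (fun t ↦ k t * cexp (-(γ₀ * I) * t)) ρ‖ ^ 2 ≤ Bf) →
      (∀ ρ ∈ P, riemannZeta ρ = 0 ∧ 0 ≤ ρ.re ∧ ρ.re ≤ 1 ∧ ρ.im ≠ 0 ∧
          ‖weilMellin (fun t ↦ k t * cexp (-(γ₀ * I) * t)) ρ‖ ^ 2 ≤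
            ‖weilMellin (fun t ↦ k t * cexp (-(γ₀ * I) * t)) ρ -
              weilMellin (fun t ↦ k t * cexp (-(γ₀ * I) * t)) (1 - conj ρ)‖ ^ 2 / 2) →
      (∀ ρ : ℂ, riemannZeta ρ = 0 → 0 ≤ ρ.re → ρ.re ≤ 1 → |ρ.im - γ₀| < R → ρ.re ≠ 1 / 2 →
          ρ = 1 / 2 + η + γ₀ * I ∨ ρ = 1 / 2 - η + γ₀ * I ∨ ρ ∈ S' ∨ ρ ∈ Sf ∨ ρ ∈ P) →
      2 * zetaDensityConst * (((∫ t : ℝ, ‖k t‖) ^ 2 + (∫ t : ℝ, ‖deriv k t‖) ^ 2)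
            + 2 * Real.exp a * (∫ t : ℝ, ‖iteratedDeriv (n + 1) k t‖) ^ 2 / R ^ (2 * n))
          * Real.log (|γ₀| + 2) + Bf
        < 2 * ((riemannZetaZeroOrder (1 / 2 + η + γ₀ * I) : ℝ)
            * ‖∫ t : ℝ, k t * cexp ((η : ℂ) * t)‖ ^ 2) →
        weilGroundEnergy a < 0 := by
  intro k a η γ₀ R Bf n S' Sf P hk hodd ha hR hks hpos hζ hη hη0 hγ hvan hSf1 hBf hP hloc hwin
  have key := weilGroundEnergy_le_local_of_oddTest_cluster_far_undodged k a η γ₀ R Bf n S' Sf P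
    hk hodd ha hR hks hpos hζ hη hη0 hγ hvan hSf1 hBf hP hloc
  exact key.trans_lt (div_neg_of_neg_of_pos (by linarith) hpos)

end Undodged

end Summit.RiemannHypothesis.RiemannHypothesis.Theorems
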